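import Summits.KontsevichZagierPeriods.KontsevichZagierPeriods.Theorems.UnfoldedStokesStokesGenerationFibrewiseBridge
import Summits.KontsevichZagierPeriods.KontsevichZagierPeriods.Theorems.UnfoldedStokesStokesGenerationFibrewiseRungSimpleRealPoles
import Summits.KontsevichZagierPeriods.KontsevichZagierPeriods.Theorems.UnfoldedStokesStokesGenerationFibrewiseRungDlogSector
import Summits.KontsevichZagierPeriods.KontsevichZagierPeriods.Theorems.UnfoldedStokesStokesGenerationFibrewiseRungAngularLoop

/-!
# `StokesGeneration` (stmt-KontsevichZagierPeriods-3586), line `fibrewise_stokes` — the rungs as KERNEL THEOREMS of the KZ calculus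

The three constructive sectors of the residual S2 landed by the line
(`fibrewiseStokesGeneration_simpleRealPoles`, `…_dlogSector`, `…_angularLoop`) conclude with the fibrewise Stokes
DECOMPOSITION of S2. Composed with the landed calibration S3 (`stub_fibrewiseStokesCalibration`: every fibrewise
Stokes element is a relation), the lifting of cube representations (`exists_liftCube`) and null-set excision
(`of_sub_sum_mem_relations_of_eqOn_off_null`) — i.e. the single-representation form of the landed bridge
`FibrewiseStokesGenerationConjecture → StokesGeneration` — they become UNCONDITIONAL instances of the crux itself,
stated in the language of the Kontsevich–Zagier calculus: the kernel elements `[[0,1], h]` of these sectors lie in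
`KZ.relations`.

* `of_mem_relations_of_fibStokesDecomposition` — a closed-cube representation admitting a fibrewise Stokes
  decomposition (the conclusion of S2) is a relation;
* `of_mem_relations_simpleRealPoles` — `[[0,1], Σᵢ cᵢ/(z − aᵢ)] ∈ relations` when its value vanishes
  (real algebraic simple poles off `[0,1]`; Baker);
* `of_mem_relations_dlogSector` — `[[0,1], g₀ + Σᵢ cᵢ pᵢ'/pᵢ] ∈ relations` when its value vanishes
  (exact part + logarithmic derivatives of positive real-algebraic polynomials; inhomogeneous Baker);
* `of_mem_relations_angularLoop` — `[[0,1], γ (A B' − A' B)/(A² + B²)] ∈ relations` for a complex polynomial loop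
  `A + iB` with positive real part and `B(0) = B(1) = 0` (the `arctan`/`π` sector; its value is `0`).

References: M. Kontsevich, D. Zagier, *Periods* (2001), §1.2 Conjecture 1; A. Baker, *Transcendental Number Theory*
(1975), Thm. 2.1.
-/

noncomputable section

set_option linter.dupNamespace false

namespace Summit.KontsevichZagierPeriods.KontsevichZagierPeriods.Cruxes.StokesGeneration.FibrewiseStokes

open MeasureTheory Set
open Literature.ModelTheory.ExponentialFields (IsSemialgebraic)
open Literature.NumberTheory.Transcendental
open Literature.NumberTheory.Transcendental.KZ
open Summit.KontsevichZagierPeriods.KontsevichZagierPeriods.StokesGenerationLine (exists_liftCube)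

/-- **A fibrewise Stokes decomposition makes a cube representation a relation** (single-representation form of
the bridge `FibrewiseStokesGenerationConjecture → StokesGeneration`): lift `t` to the padded cube (rule (3) slabs),
excise the null set (rule (1a)), and calibrate each fibrewise Stokes element (S3).
[cite: KontsevichZagier2001, §1.2 Conjecture 1] -/
theorem of_mem_relations_of_fibStokesDecomposition :
    ∀ (M : ℕ) (t : IntegralRep M), t.domain = Set.pi Set.univ (fun _ : Fin M => Set.Icc (0:ℝ) 1) →
      (∃ (M' : ℕ) (hMM' : M ≤ M') (J : ℕ) (i : Fin J → Fin M') (G D : Fin J → (Fin M' → ℝ) → ℝ)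
        (K : Fin J → Set (Fin M' → ℝ)) (q : Fin J → IntegralRep M') (Z : Set (Fin M' → ℝ)),
        (∀ j, IsSemialgebraicFunOn ℚ (Set.pi Set.univ (fun _ : Fin M' => Set.Icc (0:ℝ) 1)) (G j) ∧
          IsSemialgebraicFunOn ℚ (Set.pi Set.univ (fun _ : Fin M' => Set.Icc (0:ℝ) 1)) (D j) ∧
          IsSemialgebraic ℚ (K j) ∧
          (∃ B : ℝ, ∀ x ∈ Set.pi Set.univ (fun _ : Fin M' => Set.Icc (0:ℝ) 1), |(G j) x| ≤ B) ∧
          (∀ x ∈ Set.pi Set.univ (fun _ : Fin M' => Set.Icc (0:ℝ) 1), Set.Finite {s : ℝ | Function.update x (i j) s ∈ (K j)}) ∧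
          (∀ x ∈ Set.pi Set.univ (fun _ : Fin M' => Set.Icc (0:ℝ) 1), ContinuousOn (fun s : ℝ => (G j) (Function.update x (i j) s)) (Set.Icc (0:ℝ) 1)) ∧
          (∀ x ∈ Set.pi Set.univ (fun _ : Fin M' => Set.Icc (0:ℝ) 1), x ∉ (K j) → x (i j) ∈ Set.Ioo (0:ℝ) 1 →
            HasDerivAt (fun s : ℝ => (G j) (Function.update x (i j) s)) ((D j) x) (x (i j)))) ∧
        (∀ j, (q j).domain = Set.pi Set.univ (fun _ : Fin M' => Set.Icc (0:ℝ) 1) ∧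
          ∀ x ∈ Set.pi Set.univ (fun _ : Fin M' => Set.Icc (0:ℝ) 1), (q j).integrand x =
            D j x - (G j (Function.update x (i j) 1) - G j (Function.update x (i j) 0))) ∧
        IsSemialgebraic ℚ Z ∧ volume Z = 0 ∧
        ∀ x ∈ Set.pi Set.univ (fun _ : Fin M' => Set.Icc (0:ℝ) 1), x ∉ Z →
          t.integrand (fun l => x (Fin.castLE hMM' l)) = ∑ j, (q j).integrand x) →
      of t ∈ relations := by
  classical
  intro M t htd hdec
  obtain ⟨M', hMM', J, i, G, D, K, q, Z, hpack, hq, hZs, hZ0, hident⟩ := hdec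
  -- lift `t` to dimension `M'`
  obtain ⟨t'', ht''d, ht''i, hlift⟩ := exists_liftCube M M' hMM' t htd
  -- `[t''] ≡ Σⱼ [q j]` off the null set `Z`
  have hsum : of t'' - ∑ j, of (q j) ∈ relations := by
    refine of_sub_sum_mem_relations_of_eqOn_off_null t'' q Z hZs hZ0
      (fun j => by rw [(hq j).1, ht''d]) ?_
    intro z hz hzZ
    rw [ht''d] at hz
    rw [ht''i z hz, hident z hz hzZ]
  -- (S3) each summand is a relation
  have hqrel : ∑ j, of (q j) ∈ relations :=
    AddSubgroup.sum_mem _ fun j _ =>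
      stub_fibrewiseStokesCalibration M' (i j) (G j) (D j) (K j) (hpack j).1 (hpack j).2.1
        (hpack j).2.2.1 (hpack j).2.2.2.1 (hpack j).2.2.2.2.1 (hpack j).2.2.2.2.2.1
        (hpack j).2.2.2.2.2.2 (q j) (hq j).1 (hq j).2
  have e : of t = (of t - of t'') + (of t'' - ∑ j, of (q j)) + ∑ j, of (q j) := by abel
  rw [e]
  exact relations.add_mem (relations.add_mem hlift hsum) hqrel

/-- **The Kontsevich–Zagier kernel conjecture on the Baker sector** (unconditional): a closed-interval representation
with integrand `Σᵢ cᵢ/(z − aᵢ)` (`aᵢ, cᵢ` real algebraic, `aᵢ ∉ [0,1]`) whose value vanishes is a relation of the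
four-move calculus. [cite: Baker1975, Thm 2.1] -/
theorem of_mem_relations_simpleRealPoles :
    ∀ (s : ℕ) (a c : Fin s → ℝ), (∀ i, IsAlgebraic ℚ (a i)) → (∀ i, IsAlgebraic ℚ (c i)) →
      (∀ i, a i < 0 ∨ 1 < a i) → ∀ (t : IntegralRep 1),
      t.domain = Set.pi Set.univ (fun _ : Fin 1 => Set.Icc (0:ℝ) 1) →
      (∀ z ∈ Set.pi Set.univ (fun _ : Fin 1 => Set.Icc (0:ℝ) 1), t.integrand z = ∑ i, c i / (z 0 - a i)) →
      t.value = 0 → of t ∈ relations :=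
  fun s a c ha hc ha01 t ht hti hval =>
    of_mem_relations_of_fibStokesDecomposition 1 t ht
      (fibrewiseStokesGeneration_simpleRealPoles s a c ha hc ha01 t ht hti hval)

/-- **The Kontsevich–Zagier kernel conjecture on the dlog sector with exact part** (unconditional): a closed-interval
representation with integrand `g₀ + Σᵢ cᵢ pᵢ'/pᵢ` (`G₀' = g₀` with `G₀, g₀` `ℚ`-semialgebraic; `pᵢ` positive
real-algebraic polynomials; `cᵢ` real algebraic) whose value vanishes is a relation. [cite: Baker1975, Thm 2.1] -/
theorem of_mem_relations_dlogSector :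
    ∀ (s : ℕ) (p : Fin s → Polynomial ℝ) (c : Fin s → ℝ) (G₀ g₀ : ℝ → ℝ),
      (∀ i n, IsAlgebraic ℚ ((p i).coeff n)) → (∀ i, IsAlgebraic ℚ (c i)) →
      (∀ i, ∀ u ∈ Set.Icc (0:ℝ) 1, 0 < (p i).eval u) →
      IsSemialgebraicFunOn ℚ (Set.pi Set.univ (fun _ : Fin 2 => Set.Icc (0:ℝ) 1)) (fun x => G₀ (x 0)) →
      IsSemialgebraicFunOn ℚ (Set.pi Set.univ (fun _ : Fin 2 => Set.Icc (0:ℝ) 1)) (fun x => g₀ (x 0)) →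
      (∀ u ∈ Set.Icc (0:ℝ) 1, HasDerivAt G₀ (g₀ u) u) → ContinuousOn g₀ (Set.Icc (0:ℝ) 1) →
      ∀ (t : IntegralRep 1), t.domain = Set.pi Set.univ (fun _ : Fin 1 => Set.Icc (0:ℝ) 1) →
      (∀ z ∈ Set.pi Set.univ (fun _ : Fin 1 => Set.Icc (0:ℝ) 1), t.integrand z =
        g₀ (z 0) + ∑ i, c i * ((Polynomial.derivative (p i)).eval (z 0) / (p i).eval (z 0))) →
      t.value = 0 → of t ∈ relations :=
  fun s p c G₀ g₀ hp hc hpos hG₀ hg₀ hder hg₀c t ht hti hval =>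
    of_mem_relations_of_fibStokesDecomposition 1 t ht
      (fibrewiseStokesGeneration_dlogSector s p c G₀ g₀ hp hc hpos hG₀ hg₀ hder hg₀c t ht hti hval)

/-- **The Kontsevich–Zagier kernel conjecture for closed angular loops with positive real part** (unconditional):
a closed-interval representation with integrand `γ (A B' − A' B)/(A² + B²)` (`A + iB` a complex polynomial with real
algebraic coefficients, `A > 0` on `[0,1]`, `B(0) = B(1) = 0`, `γ` real algebraic) is a relation.
[cite: KontsevichZagier2001, §1.2 Conjecture 1] -/
theorem of_mem_relations_angularLoop :
    ∀ (γ : ℝ) (A B : Polynomial ℝ), IsAlgebraic ℚ γ → (∀ n, IsAlgebraic ℚ (A.coeff n)) →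
      (∀ n, IsAlgebraic ℚ (B.coeff n)) → (∀ u ∈ Set.Icc (0:ℝ) 1, 0 < A.eval u) →
      B.eval 0 = 0 → B.eval 1 = 0 →
      ∀ (t : IntegralRep 1), t.domain = Set.pi Set.univ (fun _ : Fin 1 => Set.Icc (0:ℝ) 1) →
      (∀ z ∈ Set.pi Set.univ (fun _ : Fin 1 => Set.Icc (0:ℝ) 1), t.integrand z =
        γ * ((A.eval (z 0) * (Polynomial.derivative B).eval (z 0) -
          (Polynomial.derivative A).eval (z 0) * B.eval (z 0)) / (A.eval (z 0) ^ 2 + B.eval (z 0) ^ 2))) →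
      of t ∈ relations :=
  fun γ A B hγ hA hB hApos hB0 hB1 t ht hti =>
    of_mem_relations_of_fibStokesDecomposition 1 t ht
      (fibrewiseStokesGeneration_angularLoop γ A B hγ hA hB hApos hB0 hB1 t ht hti)

end Summit.KontsevichZagierPeriods.KontsevichZagierPeriods.Cruxes.StokesGeneration.FibrewiseStokes

end
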